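import Summits.ResolutionOfSingularities.ResolutionOfSingularities.Theorems.PurelyInseparableDim4TschirnhausJet
import Summits.ResolutionOfSingularities.ResolutionOfSingularities.Theorems.PurelyInseparableDim4TschirnhausStraighten
import Summits.ResolutionOfSingularities.ResolutionOfSingularities.Theorems.PurelyInseparableDim4TschirnhausCone
import Summits.ResolutionOfSingularities.ResolutionOfSingularities.Theorems.PurelyInseparableDim4TschirnhausFrameStep
import Summits.ResolutionOfSingularities.ResolutionOfSingularities.Theorems.PurelyInseparableDim4ResConeLedgerLinear
import Summits.ResolutionOfSingularities.ResolutionOfSingularities.Theorems.PurelyInseparableDim4ResConeStretchKill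
import HarnessLib
import HarnessLib.Audit.Tags

/-!
# Purely inseparable four-folds — THE CANONICAL TSCHIRNHAUS JET FRAME EXISTS: a power cone whose vertex form charges
# the letter `f` is straightened onto `x_f` and made Tschirnhaus to any order `N` by one move `x_f ↦ x_f + φ(u)`
# (cell `res-dim4-pi`, K2(p) lane, brick (ii) / slice B bricks K24a-β1 and K24b (E))

[OURS · counted 0 · cell `res-dim4-pi` · K2(p) lane (holder res-dim4-p-12 g3); K24a statement layer 2026-08-29
01:24Z stub β1, and the «re-framing at ONE state gives the straight normal form» half of the holder's ruling (iii)
for K24b (bus 02:51:49Z); seat res-dim4-p-1 g4 over res-dim4-p-11 g3's `tsch_powerCone_straighten`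
(`…TschirnhausStraighten`) and res-dim4-p-1 g3's FILE D `exists_tschirnhaus_jet_of_initialForm` (`…TschirnhausJet`).]
Nothing here proves K2(p)/K2(5), `NoIsolatedTrap p p` or resolution of singularities in dimension ≥ 4 /
characteristic `p`.  AI kernel work, weaker than expert review.

* **`exists_canonical_frame`** — for a residual `G` of order `d` whose degree-`d` part is a power cone
  `a₀·(Σ ℓᵢ xᵢ)^d` with `a₀ ≠ 0`, `ℓ_f ≠ 0` (`d` a unit of `K`), and every `N`: there is an admissible datum `φ`
  (`φ(0) = 0`, `x_f ∉ φ`) whose LINEAR PART IS THE STRAIGHTENING `−Σ_{i ≠ f} (ℓᵢ/ℓ_f) xᵢ` and such that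
  `G̃ := τ_φ G` (`x_f ↦ x_f + φ`) is STRAIGHT — `homogeneousComponent d G̃ = (a₀ ℓ_f^d)·x_f^d` — and TSCHIRNHAUS to
  order `N` — no monomial `x_f^{d−1}·u^m` with `|m| ≤ N`.  Route: compose the linear straightening (p-11) with FILE
  D's jet `φ₂` of order `≥ 2` for the straightened polynomial (`tsch_comp_tsch`); the Tschirnhaus part is inert on
  the initial form (`initialForm_tsch_of_two_le`) and on the linear coefficients.

The frame is unique to order `N` (D4 `jet_eq_of_frames`, `…TschirnhausJetCanonical`) — not restated here.
[cite: Kollar2007, Aside 3.57 (maximal contact / Tschirnhaus for order < char)] [cite: CossartJannsenSaito2020, Thm. 3.14]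
bears_on: LADDER-RESOLUTION:D157-DOOR2 (res-dim4-pi · K2(p) · slice B · K24a-β1 / K24b (E)).  Supports
stmt-ResolutionOfSingularities-16155 (helper).
-/

set_option linter.dupNamespace false -- mandated namespace of this single-conjunct summit

noncomputable section

namespace Summit.ResolutionOfSingularities.ResolutionOfSingularities.Theorems.PIDim4

namespace FrameChange

open MvPolynomial Finset
open Literature.AlgebraicGeometry.Resolution
open Literature.AlgebraicGeometry.Resolution.Hauser2010
open Literature.AlgebraicGeometry.Resolution.HauserPerlega2019
open Literature.AlgebraicGeometry.Resolution.CentreBlowup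

variable {K : Type} [Field K]

/-- The straightening coefficients `c_i = −ℓ_i/ℓ_f` (`i ≠ f`), `c_f = 0`. [folklore] -/
theorem straighten_coeff_of_ne (ℓ : Fin 4 → K) {f i : Fin 4} (hi : i ≠ f) :
    (fun i => if i = f then (0 : K) else -(ℓ i / ℓ f)) i = -(ℓ i / ℓ f) := by
  simp [hi]

/-- **THE CANONICAL TSCHIRNHAUS JET FRAME EXISTS** (K24a-β1 / K24b (E), statement in the module docstring). [OURS]
[cite: Kollar2007, Aside 3.57 (maximal contact / Tschirnhaus for order < char)] -/
theorem exists_canonical_frame (f : Fin 4) {d : ℕ} (hd : 1 ≤ d) (hdK : (d : K) ≠ 0) {G : MvPolynomial (Fin 4) K}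
    (hord : ordZero G = (d : ℕ)) {a₀ : K} {ℓ : Fin 4 → K} (ha₀ : a₀ ≠ 0) (hℓf : ℓ f ≠ 0)
    (hcone : homogeneousComponent d G = C a₀ * (∑ i, C (ℓ i) * X i) ^ d) (N : ℕ) :
    ∃ φ : MvPolynomial (Fin 4) K, constantCoeff φ = 0 ∧ f ∉ φ.vars ∧
      (∀ i, i ≠ f → coeff (Finsupp.single i 1) φ = -(ℓ i / ℓ f)) ∧
      homogeneousComponent d (tsch f φ G) = C (a₀ * ℓ f ^ d) * X f ^ d ∧
      ∀ n : Fin 4 →₀ ℕ, n f = d - 1 → n.degree ≤ N + (d - 1) → coeff n (tsch f φ G) = 0 := by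
  classical
  -- the linear straightening
  set c : Fin 4 → K := fun i => if i = f then (0 : K) else -(ℓ i / ℓ f) with hc
  set lin : MvPolynomial (Fin 4) K := ∑ i, C (c i) * X i with hlin
  obtain ⟨hlinv, hlin0, hlin1⟩ := straighten_datum_admissible (K := K) (f := f) ℓ
  set G₁ := tsch f lin G with hG₁
  have hin : initialForm G = homogeneousComponent d G := Directrix.initialForm_eq_homogeneousComponent hord
  have hord₁ : ordZero G₁ = (d : ℕ) := by rw [hG₁, ordZero_tsch hlinv hlin0, hord]
  have hin₁ : initialForm G₁ = C (a₀ * ℓ f ^ d) * X f ^ d := by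
    rw [hG₁, initialForm_tsch_of_isHomogeneous_one hlinv hlin1, hin, hcone]
    exact tsch_powerCone_straighten hℓf a₀ d
  -- the Tschirnhaus jet of the straightened polynomial
  obtain ⟨φ₂, h0₂, hv₂, h2₂, hjet⟩ := exists_tschirnhaus_jet_of_initialForm f hd hdK G₁
    (straighten_coeff_ne_zero ha₀ hℓf d) hord₁ hin₁ N
  refine ⟨lin + φ₂, ?_, ?_, ?_, ?_, ?_⟩
  · rw [map_add, hlin0, h0₂, add_zero]
  · intro hf
    rcases Finset.mem_union.mp (MvPolynomial.vars_add_subset _ _ hf) with h | h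
    · exact hlinv h
    · exact hv₂ h
  · intro i hi
    rw [coeff_add, hlin, ResCone.coeff_single_linearForm, coeff_eq_zero_of_degree_lt_ordZero
      (lt_of_lt_of_le (by rw [Finsupp.degree_single]; exact_mod_cast (by norm_num : (1 : ℕ) < 2)) h2₂), add_zero,
      hc, straighten_coeff_of_ne ℓ hi]
  · have hcomp : tsch f (lin + φ₂) G = tsch f φ₂ G₁ := by
      rw [hG₁, ← AlgHom.comp_apply, tsch_comp_tsch φ₂ hlinv]
    rw [hcomp, ← Directrix.initialForm_eq_homogeneousComponent (by rw [ordZero_tsch hv₂ h0₂, hord₁]),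
      initialForm_tsch_of_two_le hv₂ h2₂, hin₁]
  · intro n hnf hn
    have hcomp : tsch f (lin + φ₂) G = tsch f φ₂ G₁ := by
      rw [hG₁, ← AlgHom.comp_apply, tsch_comp_tsch φ₂ hlinv]
    rw [hcomp]
    exact hjet (tsch f φ₂) (tsch_X_self f φ₂) (fun i hi => tsch_X_of_ne φ₂ hi) n hnf hn

/-- **The canonical frame of a presented state** (the same, dressed for a state `s` with `x^r ∣ F`, `r_f = 0`,
`ord₀ F = o`, residual cone `resForm s = a₀·(Σ ℓᵢ xᵢ)^d`, `d = o − |r|`): a frame `φ` at `f`, linear part the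
straightening, with `τ_φ (F / x^r)` straight and Tschirnhaus to order `N`. [OURS]
[cite: Kollar2007, Aside 3.57 (maximal contact / Tschirnhaus for order < char)] -/
theorem exists_canonical_frame_state (f : Fin 4) {d : ℕ} (hd : 1 ≤ d) (hdK : (d : K) ≠ 0) {s : State K} {o : ℕ}
    (ho : ordZero s.F = o) (hr : ∀ e ∈ s.F.support, s.r ≤ e) (hod : o - s.r.degree = d)
    {a₀ : K} {ℓ : Fin 4 → K} (ha₀ : a₀ ≠ 0) (hℓf : ℓ f ≠ 0)
    (hform : ResCone.resForm s = C a₀ * (∑ i, C (ℓ i) * X i) ^ d) (N : ℕ) :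
    ∃ φ : MvPolynomial (Fin 4) K, constantCoeff φ = 0 ∧ f ∉ φ.vars ∧
      (∀ i, i ≠ f → coeff (Finsupp.single i 1) φ = -(ℓ i / ℓ f)) ∧
      homogeneousComponent d (tsch f φ (s.F.divMonomial s.r)) = C (a₀ * ℓ f ^ d) * X f ^ d ∧
      ∀ n : Fin 4 →₀ ℕ, n f = d - 1 → n.degree ≤ N + (d - 1) → coeff n (tsch f φ (s.F.divMonomial s.r)) = 0 := by
  have hcone : homogeneousComponent d (s.F.divMonomial s.r) = C a₀ * (∑ i, C (ℓ i) * X i) ^ d := by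
    rw [← hod, ← ResCone.resForm_eq_homogeneousComponent_divMonomial ho hr, hod]; exact hform
  have hordG : ordZero (s.F.divMonomial s.r) = (d : ℕ) := by
    rw [ResCone.ordZero_divMonomial_eq ho hr, hod]
  exact exists_canonical_frame f hd hdK hordG ha₀ hℓf hcone N

end FrameChange

end Summit.ResolutionOfSingularities.ResolutionOfSingularities.Theorems.PIDim4

end
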